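import Literature.Probability.Percolation.InterfaceCurves
import Literature.Probability.RandomPlanarGeometry.CurveTortuosity
import Literature.Probability.RandomPlanarGeometry.CurveSpace
import HarnessLib

/-!
# No idling of the limit interface, part 4: the alternation event around a point

Helper file for the registered stub `stub_limitCurveRegularity_noIdle` of line
`hitting-tournament` of crux `LagHandOff` (stmt-CriticalPhenomena-10268).  A curve `c`
ALTERNATES around the point `g` with thresholds `(ε₁, r₁)` if it is far (`> r₁`) from `g` at
both ends and there are parameters `t₁ < t₂ < t₃` at which it is near (`< ε₁`), far, near.
This is the footprint, on one curve, of a return to `g` after an excursion — two visits of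
`B(g, ε₁)` separated and flanked by visits of `{dist > r₁}`.  Written with STRICT
inequalities the condition is open for the uniform distance up to reparametrisation, hence a
property of the curve CLASS and an open event of classes:

* `exists_forall_alternates_of_dist_lt` — stability under small reparametrisation distance;
* `alternates_of_mk_eq` — invariance under change of representative;
* `isOpen_setOf_exists_alternates` — the event `{γ | some representative alternates}` is open
  in `CurveClass ℂ` (image of an open saturated set under the open quotient map);
* `alternates_reverse` — invariance under time reversal (the pattern is palindromic);
* `hasTraversals_three_of_alternates` — an alternating curve traverses the shell
  `D(g; ε₁, r₁)` three separate times (`Curve.HasTraversals 3`), the input of the dictionary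
  `fourArm_of_hasTraversals`;
* `exists_mem_Ioo_mem_of_isOpen` — a continuity helper (a curve in an open set at time `t`
  stays in it at some time of `(t, t')`).

References: M. Aizenman, A. Burchard, Duke Math. J. 99 (1999), §1.b (1.2)–(1.3) (separate
traversals of a shell); §2.1 (the metric).
-/

noncomputable section

open Set Filter Topology Metric
open scoped unitInterval
open Literature.Probability.Percolation Literature.Probability.RandomPlanarGeometry

namespace Summit.CriticalPhenomena.CardyFormulaZ2.Cruxes.LagHandOff.HittingTournament

/-! ### Continuity helpers -/

/-- **A curve in an open set at time `t` is in it at some time of `(t, t')`** (`t < t'`). -/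
theorem exists_mem_Ioo_mem_of_isOpen {Y : Type*} [TopologicalSpace Y] (c : Curve Y) {U : Set Y}
    (hU : IsOpen U) {t t' : I} (htt' : t < t') (ht : c t ∈ U) : ∃ u ∈ Ioo t t', c u ∈ U := by
  have hopen : IsOpen ((c : I → Y) ⁻¹' U) := hU.preimage c.continuous
  obtain ⟨ε, hε, hball⟩ := Metric.isOpen_iff.1 hopen t ht
  have htt'r : (t : ℝ) < t' := Subtype.coe_lt_coe.2 htt'
  set ur : ℝ := min (((t : ℝ) + t') / 2) (t + ε / 2) with hur
  have htu : (t : ℝ) < ur := lt_min (by linarith) (by linarith)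
  have hut' : ur < t' := lt_of_le_of_lt (min_le_left _ _) (by linarith)
  have hu0 : 0 ≤ ur := (unitInterval.nonneg t).trans htu.le
  have hu1 : ur ≤ 1 := hut'.le.trans (unitInterval.le_one t')
  refine ⟨⟨ur, hu0, hu1⟩, ⟨Subtype.coe_lt_coe.1 htu, Subtype.coe_lt_coe.1 hut'⟩, ?_⟩
  have hdist : dist (⟨ur, hu0, hu1⟩ : I) t < ε := by
    rw [Subtype.dist_eq, Real.dist_eq, abs_lt]
    have : ur ≤ (t : ℝ) + ε / 2 := min_le_right _ _
    constructor
    · show -ε < ur - t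
      linarith
    · show ur - t < ε
      linarith
  exact hball hdist

/-! ### Stability of the alternation pattern -/

/-- **Stability of the alternation pattern under small reparametrisation distance.** If `c`
alternates around `g` with thresholds `(ε₁, r₁)` (strict inequalities), then so does every
curve at reparametrisation distance less than the smallest slack of the five inequalities
(compose the witnessing times with an almost-optimal reparametrisation).
[cite: AizenmanBurchard1999, §2.1] -/
theorem exists_forall_alternates_of_dist_lt {c : Curve ℂ} {g : ℂ} {ε₁ r₁ : ℝ}
    (h : ∃ t₁ t₂ t₃ : I, t₁ < t₂ ∧ t₂ < t₃ ∧ dist (c t₁) g < ε₁ ∧ r₁ < dist (c t₂) g ∧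
      dist (c t₃) g < ε₁ ∧ r₁ < dist (c 0) g ∧ r₁ < dist (c 1) g) :
    ∃ η : ℝ, 0 < η ∧ ∀ c' : Curve ℂ, dist c c' < η →
      ∃ t₁ t₂ t₃ : I, t₁ < t₂ ∧ t₂ < t₃ ∧ dist (c' t₁) g < ε₁ ∧ r₁ < dist (c' t₂) g ∧
        dist (c' t₃) g < ε₁ ∧ r₁ < dist (c' 0) g ∧ r₁ < dist (c' 1) g := by
  obtain ⟨t₁, t₂, t₃, h12, h23, h1, h2, h3, h0, h1'⟩ := h
  set η : ℝ := min (min (ε₁ - dist (c t₁) g) (dist (c t₂) g - r₁))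
    (min (ε₁ - dist (c t₃) g) (min (dist (c 0) g - r₁) (dist (c 1) g - r₁))) with hη
  have hηpos : 0 < η := by
    simp only [hη, lt_min_iff]
    exact ⟨⟨by linarith, by linarith⟩, by linarith, by linarith, by linarith⟩
  have hη1 : η ≤ ε₁ - dist (c t₁) g := (min_le_left _ _).trans (min_le_left _ _)
  have hη2 : η ≤ dist (c t₂) g - r₁ := (min_le_left _ _).trans (min_le_right _ _)
  have hη3 : η ≤ ε₁ - dist (c t₃) g := (min_le_right _ _).trans (min_le_left _ _)
  have hη4 : η ≤ dist (c 0) g - r₁ :=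
    (min_le_right _ _).trans ((min_le_right _ _).trans (min_le_left _ _))
  have hη5 : η ≤ dist (c 1) g - r₁ :=
    (min_le_right _ _).trans ((min_le_right _ _).trans (min_le_right _ _))
  refine ⟨η, hηpos, fun c' hcc' => ?_⟩
  obtain ⟨φ, hφ⟩ := Curve.exists_dist_reparam_lt hcc'
  have hclose : ∀ t : I, dist (c t) (c' (φ t)) < η := fun t => by
    have := ContinuousMap.dist_apply_le_dist (f := c.toContinuousMap)
      (g := (c'.reparam φ).toContinuousMap) (x := t)
    simp only [Curve.coe_toContinuousMap, Curve.reparam_apply] at this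
    exact this.trans_lt hφ
  have hφ0 : φ 0 = 0 := φ.map_bot
  have hφ1 : φ 1 = 1 := φ.map_top
  refine ⟨φ t₁, φ t₂, φ t₃, φ.lt_iff_lt.2 h12, φ.lt_iff_lt.2 h23, ?_, ?_, ?_, ?_, ?_⟩
  · linarith [dist_triangle (c' (φ t₁)) (c t₁) g, dist_comm (c t₁) (c' (φ t₁)), hclose t₁]
  · linarith [dist_triangle (c t₂) (c' (φ t₂)) g, hclose t₂]
  · linarith [dist_triangle (c' (φ t₃)) (c t₃) g, dist_comm (c t₃) (c' (φ t₃)), hclose t₃]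
  · have := hclose 0
    rw [hφ0] at this
    linarith [dist_triangle (c 0) (c' 0) g]
  · have := hclose 1
    rw [hφ1] at this
    linarith [dist_triangle (c 1) (c' 1) g]

/-- **The alternation pattern is a property of the curve class.** -/
theorem alternates_of_mk_eq {c c' : Curve ℂ} {g : ℂ} {ε₁ r₁ : ℝ}
    (h : ∃ t₁ t₂ t₃ : I, t₁ < t₂ ∧ t₂ < t₃ ∧ dist (c t₁) g < ε₁ ∧ r₁ < dist (c t₂) g ∧
      dist (c t₃) g < ε₁ ∧ r₁ < dist (c 0) g ∧ r₁ < dist (c 1) g)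
    (hcc' : CurveClass.mk c = CurveClass.mk c') :
    ∃ t₁ t₂ t₃ : I, t₁ < t₂ ∧ t₂ < t₃ ∧ dist (c' t₁) g < ε₁ ∧ r₁ < dist (c' t₂) g ∧
      dist (c' t₃) g < ε₁ ∧ r₁ < dist (c' 0) g ∧ r₁ < dist (c' 1) g := by
  obtain ⟨η, hη, hall⟩ := exists_forall_alternates_of_dist_lt h
  exact hall c' (by rw [CurveClass.mk_eq_mk_iff_dist_eq_zero.1 hcc']; exact hη)

/-- **The set of alternating curves is open** (for the reparametrisation pseudo-distance). -/
theorem isOpen_setOf_alternates (g : ℂ) (ε₁ r₁ : ℝ) :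
    IsOpen {c : Curve ℂ | ∃ t₁ t₂ t₃ : I, t₁ < t₂ ∧ t₂ < t₃ ∧ dist (c t₁) g < ε₁ ∧
      r₁ < dist (c t₂) g ∧ dist (c t₃) g < ε₁ ∧ r₁ < dist (c 0) g ∧ r₁ < dist (c 1) g} := by
  rw [Metric.isOpen_iff]
  intro c hc
  obtain ⟨η, hη, hall⟩ := exists_forall_alternates_of_dist_lt hc
  exact ⟨η, hη, fun c' hc' => hall c' (by rw [dist_comm]; exact hc')⟩

/-- **The alternation event of curve classes is open** in `CurveClass ℂ`: it is the image of
the open set of alternating curves under the open quotient map `CurveClass.mk`. -/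
theorem isOpen_setOf_exists_alternates (g : ℂ) (ε₁ r₁ : ℝ) :
    IsOpen {γ : CurveClass ℂ | ∃ c : Curve ℂ, CurveClass.mk c = γ ∧
      ∃ t₁ t₂ t₃ : I, t₁ < t₂ ∧ t₂ < t₃ ∧ dist (c t₁) g < ε₁ ∧ r₁ < dist (c t₂) g ∧
        dist (c t₃) g < ε₁ ∧ r₁ < dist (c 0) g ∧ r₁ < dist (c 1) g} := by
  have heq : {γ : CurveClass ℂ | ∃ c : Curve ℂ, CurveClass.mk c = γ ∧
      ∃ t₁ t₂ t₃ : I, t₁ < t₂ ∧ t₂ < t₃ ∧ dist (c t₁) g < ε₁ ∧ r₁ < dist (c t₂) g ∧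
        dist (c t₃) g < ε₁ ∧ r₁ < dist (c 0) g ∧ r₁ < dist (c 1) g} =
      CurveClass.mk '' {c : Curve ℂ | ∃ t₁ t₂ t₃ : I, t₁ < t₂ ∧ t₂ < t₃ ∧ dist (c t₁) g < ε₁ ∧
        r₁ < dist (c t₂) g ∧ dist (c t₃) g < ε₁ ∧ r₁ < dist (c 0) g ∧ r₁ < dist (c 1) g} := by
    ext γ
    simp only [mem_setOf_eq, mem_image]
    constructor
    · rintro ⟨c, hc, h⟩; exact ⟨c, h, hc⟩
    · rintro ⟨c, h, hc⟩; exact ⟨c, hc, h⟩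
  rw [heq, CurveClass.mk_eq_separationQuotientMk]
  exact SeparationQuotient.isOpenMap_mk _ (isOpen_setOf_alternates g ε₁ r₁)

/-- **The alternation pattern is palindromic**: it passes to the time reversal. -/
theorem alternates_reverse {c : C(I, ℂ)} {g : ℂ} {ε₁ r₁ : ℝ}
    (h : ∃ t₁ t₂ t₃ : I, t₁ < t₂ ∧ t₂ < t₃ ∧ dist ((⟨c⟩ : Curve ℂ) t₁) g < ε₁ ∧
      r₁ < dist ((⟨c⟩ : Curve ℂ) t₂) g ∧ dist ((⟨c⟩ : Curve ℂ) t₃) g < ε₁ ∧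
      r₁ < dist ((⟨c⟩ : Curve ℂ) 0) g ∧ r₁ < dist ((⟨c⟩ : Curve ℂ) 1) g) :
    ∃ t₁ t₂ t₃ : I, t₁ < t₂ ∧ t₂ < t₃ ∧ dist ((⟨reverseCurve c⟩ : Curve ℂ) t₁) g < ε₁ ∧
      r₁ < dist ((⟨reverseCurve c⟩ : Curve ℂ) t₂) g ∧
      dist ((⟨reverseCurve c⟩ : Curve ℂ) t₃) g < ε₁ ∧
      r₁ < dist ((⟨reverseCurve c⟩ : Curve ℂ) 0) g ∧ r₁ < dist ((⟨reverseCurve c⟩ : Curve ℂ) 1) g := by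
  obtain ⟨t₁, t₂, t₃, h12, h23, h1, h2, h3, h0, h1'⟩ := h
  have hc : ∀ t, (⟨c⟩ : Curve ℂ) t = c t := fun t => rfl
  have hr : ∀ t, (⟨reverseCurve c⟩ : Curve ℂ) t = c (σ t) := fun t => rfl
  simp only [hc] at h1 h2 h3 h0 h1'
  refine ⟨σ t₃, σ t₂, σ t₁, unitInterval.symm_lt_symm.2 h23, unitInterval.symm_lt_symm.2 h12,
    ?_, ?_, ?_, ?_, ?_⟩
  · rw [hr, unitInterval.symm_symm]; exact h3
  · rw [hr, unitInterval.symm_symm]; exact h2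
  · rw [hr, unitInterval.symm_symm]; exact h1
  · rw [hr, unitInterval.symm_zero]; exact h1'
  · rw [hr, unitInterval.symm_one]; exact h0

/-- **An alternating curve traverses the shell three separate times.** From the times
`t₁ < t₂ < t₃` of the pattern (near, far, near; far at `0`), moved slightly right at `t₁`
and `t₂` by continuity, the segments `[0, t₁]`, `[t₁', t₂]`, `[t₂', t₃]` traverse
`D(g; ε₁, r₁)` on disjoint parameter intervals. [cite: AizenmanBurchard1999, §1.b (1.3)] -/
theorem hasTraversals_three_of_alternates {c : Curve ℂ} {g : ℂ} {ε₁ r₁ : ℝ}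
    (h : ∃ t₁ t₂ t₃ : I, t₁ < t₂ ∧ t₂ < t₃ ∧ dist (c t₁) g < ε₁ ∧ r₁ < dist (c t₂) g ∧
      dist (c t₃) g < ε₁ ∧ r₁ < dist (c 0) g ∧ r₁ < dist (c 1) g) :
    c.HasTraversals 3 g ε₁ r₁ := by
  obtain ⟨t₁, t₂, t₃, h12, h23, h1, h2, h3, h0, -⟩ := h
  obtain ⟨t₁', ⟨h11', h1'2⟩, h1'⟩ :=
    exists_mem_Ioo_mem_of_isOpen c (U := {z | dist z g < ε₁})
      (isOpen_lt (continuous_id.dist continuous_const) continuous_const) h12 h1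
  obtain ⟨t₂', ⟨h22', h2'3⟩, h2'⟩ :=
    exists_mem_Ioo_mem_of_isOpen c (U := {z | r₁ < dist z g})
      (isOpen_lt continuous_const (continuous_id.dist continuous_const)) h23 h2
  simp only [mem_setOf_eq] at h1' h2'
  refine ⟨![0, t₁', t₂'], ![t₁, t₂, t₃], ?_, ?_⟩
  · intro i
    fin_cases i
    · exact ⟨unitInterval.nonneg', Or.inr ⟨h0.le, h1.le⟩⟩
    · exact ⟨h1'2.le, Or.inl ⟨h1'.le, h2.le⟩⟩
    · exact ⟨h2'3.le, Or.inr ⟨h2'.le, h3.le⟩⟩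
  · intro i j hij
    fin_cases i <;> fin_cases j
    all_goals first
      | exact absurd hij (by decide)
      | skip
    · exact h11'
    · exact h12.trans h22'
    · exact h22'

/-! ### The alternation event -/

/-- **The alternation event** of curve classes around the point `g` with thresholds
`(ε₁, r₁)`: some (equivalently, by `alternates_of_mk_eq`, every) representative is far
(`> r₁`) from `g` at both ends and near (`< ε₁`), far, near at three increasing parameters.
[cite: AizenmanBurchard1999, §1.b (1.3)] -/
def altEvent (g : ℂ) (ε₁ r₁ : ℝ) : Set (CurveClass ℂ) :=
  {γ | ∃ c : Curve ℂ, CurveClass.mk c = γ ∧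
    ∃ t₁ t₂ t₃ : I, t₁ < t₂ ∧ t₂ < t₃ ∧ dist (c t₁) g < ε₁ ∧ r₁ < dist (c t₂) g ∧
      dist (c t₃) g < ε₁ ∧ r₁ < dist (c 0) g ∧ r₁ < dist (c 1) g}

/-- Unfolding `altEvent`. -/
theorem mem_altEvent_iff {γ : CurveClass ℂ} {g : ℂ} {ε₁ r₁ : ℝ} :
    γ ∈ altEvent g ε₁ r₁ ↔ ∃ c : Curve ℂ, CurveClass.mk c = γ ∧
      ∃ t₁ t₂ t₃ : I, t₁ < t₂ ∧ t₂ < t₃ ∧ dist (c t₁) g < ε₁ ∧ r₁ < dist (c t₂) g ∧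
        dist (c t₃) g < ε₁ ∧ r₁ < dist (c 0) g ∧ r₁ < dist (c 1) g :=
  Iff.rfl

/-- **A class is in the alternation event iff a given representative alternates.** -/
theorem mk_mem_altEvent_iff {c : Curve ℂ} {g : ℂ} {ε₁ r₁ : ℝ} :
    CurveClass.mk c ∈ altEvent g ε₁ r₁ ↔
      ∃ t₁ t₂ t₃ : I, t₁ < t₂ ∧ t₂ < t₃ ∧ dist (c t₁) g < ε₁ ∧ r₁ < dist (c t₂) g ∧
        dist (c t₃) g < ε₁ ∧ r₁ < dist (c 0) g ∧ r₁ < dist (c 1) g :=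
  ⟨fun ⟨_, hc', h⟩ => alternates_of_mk_eq h hc', fun h => ⟨c, rfl, h⟩⟩

/-- **The alternation event is open.** -/
theorem isOpen_altEvent (g : ℂ) (ε₁ r₁ : ℝ) : IsOpen (altEvent g ε₁ r₁) :=
  isOpen_setOf_exists_alternates g ε₁ r₁

/-- **The alternation event shrinks when the far threshold grows.** -/
theorem altEvent_mono {g : ℂ} {ε₁ r₁ r₁' : ℝ} (h : r₁ ≤ r₁') : altEvent g ε₁ r₁' ⊆ altEvent g ε₁ r₁ := by
  rintro γ ⟨c, hc, t₁, t₂, t₃, h12, h23, h1, h2, h3, h0, h1'⟩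
  exact ⟨c, hc, t₁, t₂, t₃, h12, h23, h1, h.trans_lt h2, h3, h.trans_lt h0, h.trans_lt h1'⟩

/-- **Registered sub-stub `stub_noIdle_alternation`** (line `hitting-tournament`, stub
`stub_limitCurveRegularity_noIdle`, helper 4): `hasTraversals_three_of_alternates` with all
arguments explicit. [cite: AizenmanBurchard1999, §1.b (1.3)] -/
theorem stub_noIdle_alternation : ∀ (c : Curve ℂ) (g : ℂ) (ε₁ r₁ : ℝ), (∃ t₁ t₂ t₃ : unitInterval, t₁ < t₂ ∧ t₂ < t₃ ∧ dist (c t₁) g < ε₁ ∧ r₁ < dist (c t₂) g ∧ dist (c t₃) g < ε₁ ∧ r₁ < dist (c 0) g ∧ r₁ < dist (c 1) g) → c.HasTraversals 3 g ε₁ r₁ :=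
  fun _ _ _ _ h => hasTraversals_three_of_alternates h

end Summit.CriticalPhenomena.CardyFormulaZ2.Cruxes.LagHandOff.HittingTournament

end
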